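/-
Copyright (c) 2026 the pub-hodgecm-mathlib formalisation cell (harness21).  Prover seat hodgecm-mathlib-F0P3a-p03 (g20): line LH7 (closer row `stub_PKtupleK2`, #181 III-127;
h413 = stmt-HodgeConjecture-24833), leaf ED. 3 road «H-SIDE CONSTRUCTION ROWS», MEMO-ED3.v2 §7 (c) census of the print letter O8b (LH7-p03 (g3) deal 2026-09-02T07:05:31Z); 2026-09-02.
-/
import Summits.HodgeConjecture.HodgeConjecture.Theorems.F0P3cPKtupleU1Line           -- ★ (γ′) p849966∕p849979: `realises₂_of_forall_apply_eq_smul`, `realises₂_ofChar`, `isAutomorphic_eta_mul_psi` (+ ★ (β) p849785 `Realises₂`, O8b `PKmultOneU2Shape`; ★ `cmDetChar`)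
import Literature.NumberTheory.Automorphic.AutomorphicCharacterLineUnique                  -- ★ p850105 (this seat): `DiscreteAutomorphicRep.eq_ofChar_of_forall_apply_eq_smul`, `eq_of_forall_apply_eq_smul` (multiplicity one for automorphic characters, any datum)
import HarnessLib

/-!
# LH7 leaf ED. 3, O8b census — the print letter `PKmultOneU2Shape L` («multiplicity one for one-dimensional automorphic representations of `U(Φ₂)`»)
# SPLITS as ISOTYPY (print) + LINE UNIQUENESS (★): «`P₂ = P₂′`» holds for every pair of `((η ψ) ∘ det)`-scalar discrete automorphic `P₂, P₂′`
# ([Rogawski1990] §13.3 p. 203 «`m(ξ) = 1`»; [Gelbart1975] Thm. 10.10)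

Cell `pub/hodgecm-mathlib` (D-0151), crux H413 = `stmt-HodgeConjecture-24833`, half A line LH7, leaf `Cruxes/H413/Lines/F0_P3c_PKtuplePaydown.lean` ED. 2; banked road to
ED. 3 (LH7-plan (g2) `MEMO-ED3.v2`; §7 (c) «whether O8b is PRINT S or folded … as ★»).  THEOREMS ONLY (kernel lane; no `def`, no instance, no notation, no named fact, no
`sorry`).  THE CENSUS RESULT, AS THEOREMS.  The letter O8b ★ (β) `PKmultOneU2Shape L` — «`Realises₂ P₂ ξ → Realises₂ P₂′ ξ → P₂ = P₂′` for discrete automorphic `P₂, P₂′`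
of `U(Φ₂)` in `L²(μ₂)`» — has two halves of different nature:
* **(O8b♯) LINE UNIQUENESS — ★, generic** (★ `AutomorphicCharacterLineUnique`, this seat, no commutativity): two discrete automorphic representations of ANY datum on which
  `G(𝔸)` acts through the scalars of the SAME unitary automorphic character coincide — both are the line `ofChar` of that character (the `ψ⁻¹`-eigenspace of `R` in `L²`
  is one-dimensional: ergodicity of `G(𝔸)` on its automorphic quotient);
* **(O8b♭) ISOTYPY — PRINT** (stated here only as the hypothesis text `hiso`, never as a definition): «a discrete automorphic `P₂` of `U(Φ₂)` realising the character family
  `ξ_v ∘ inl = (η_v ψ_v) ∘ det₀` at every finite place (★ `Realises₂ P₂ ξ`) is `((η ψ) ∘ det)`-SCALAR: `R(g) f = (η ψ)(det g) · f` on `P₂` for all `g ∈ U(Φ₂)(𝔸)`».  Its content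
  is (i) LOCAL: a UNITARY smooth representation of `U(Φ₂)(L⁺_v)` all of whose irreducible subquotients are the character `χ_v` is `χ_v`-isotypic — for every compact open
  `K′ ≤ U(Φ₂)(L⁺_v)` the `K′`-types of such a representation are `χ_v|_{K′}` (a vector of another type generates a subrepresentation with an irreducible quotient `≅ χ_v`
  in which its image is `0`), so the open subgroup generated by the compact open subgroups acts by `χ_v`; at a place `v` SPLIT in `L` (`U(Φ₂)(L⁺_v) ≅ GL₂(L_w)`) the
  quotient by that subgroup is `ℤ` (via `ord ∘ det`) and the algebraic statement FAILS (`g ↦ [[1, ord det g], [0, 1]] ⊗ χ_v` has only the constituent `χ_v`), so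
  unitarity (orthogonal complements) is load-bearing; (ii) ARCHIMEDEAN: `Realises₂` constrains the finite places only; the `U(Φ₂)(L⁺ ⊗ ℝ)`-component is pinned through
  `f(γ g) = f(g)` for `γ ∈ U(Φ₂)(L⁺)` DENSE in `U(Φ₂)(L⁺ ⊗ ℝ)` (weak approximation at the archimedean places) — both textbook ([Rogawski1990] §13.3 p. 203; [PlatonovRapinchuk1994]
  §7.3 Prop. 7.8, §7.4 Thm. 7.12), neither in the tree.
CONTENTS (namespace `…Cruxes.H413.F0P3cPKtupleU2LineUnique`):
* §1 `eq_ofChar_of_forall_apply_eq_smul₂` — a `((η ψ) ∘ det)`-scalar discrete automorphic `P₂` of `U(Φ₂)` IS the line `ofChar ((η ψ) ∘ det)⁻¹ μ₂` (hence realises `ξ`, ★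
  `realises₂_ofChar`): `realises₂_of_forall_apply_eq_smul'` re-derived through the line; `eq_of_forall_apply_eq_smul₂` — two such `P₂, P₂′` are EQUAL;
  `realises₂_and_forall_apply_eq_smul_iff_eq_ofChar` — «realises `ξ` and is `((η ψ) ∘ det)`-scalar» ↔ «is THE line».
* §2 **`pkMultOneU2Shape_of_isotypy`** — `PKmultOneU2Shape L ⟸` the ISOTYPY text (O8b♭); `realises₂_unique_of_isotypy_at` (pointwise form at one `(μ₂, ξ)`, the premise ★
  `F0P3cPKtupleNHOneOfKD5H.nH_eq_one_of_kd5Hflat` consumes).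
HONEST LABEL: count-neutral; O8b stays a PRINT organ of the banked ED. 3 until (O8b♭) is typed∕paid — this file only moves its `L²`-uniqueness half in-house and records
the exact residual; HC_CM is proved only modulo the 7 printed citations (2 remaining: hLiu418 = stmt-HodgeConjecture-24832, h413 = stmt-HodgeConjecture-24833) until rung 0
closes.

## References
* [Rogawski1990] J. D. Rogawski, *Automorphic Representations of Unitary Groups in Three Variables*, Ann. of Math. Stud. 123 (1990): §13.3 pp. 202–203 (`m(ξ) = 1`,
  «`n(ξ) = 1`»), §12.1 p. 171.
* [Gelbart1975] S. Gelbart, *Automorphic forms on adele groups* (1975), §2.A; Thm. 10.10 (proof, p. 158).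
* [PlatonovRapinchuk1994] V. Platonov, A. Rapinchuk, *Algebraic Groups and Number Theory* (1994), §7.3 Prop. 7.8 (weak approximation), §7.4 Thm. 7.12 p. 427.
-/

set_option autoImplicit false
-- the mandated namespace repeats the single-problem summit's segment (`HodgeConjecture.HodgeConjecture`)
set_option linter.dupNamespace false

noncomputable section

namespace Summit.HodgeConjecture.HodgeConjecture.Cruxes.H413.F0P3cPKtupleU2LineUnique

open MeasureTheory NumberField IsDedekindDomain
open Literature.NumberTheory Literature.NumberTheory.Automorphic Literature.NumberTheory.Automorphic.UnitaryGroup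
open Literature.NumberTheory.Rogawski1990 Literature.NumberTheory.GaloisRepresentations
open Literature.NumberTheory.Automorphic.Arthur2013.Leaves.TECR
open Summit.HodgeConjecture.HodgeConjecture.Cruxes.H413.F0P3GlobalPacketDiscrete
open Summit.HodgeConjecture.HodgeConjecture.Cruxes.H413.F0P3cPKtupleHSideLetters
open Summit.HodgeConjecture.HodgeConjecture.Cruxes.H413.F0P3cPKtupleU1Line

variable {L : Type} [Field L] [NumberField L] [IsCMField L]

/-! ## §1 A `((η ψ) ∘ det)`-scalar discrete automorphic representation of `U(Φ₂)` is THE character line -/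

/-- **A `((η ψ) ∘ det)`-SCALAR discrete automorphic `P₂` of `U(Φ₂)` IS THE LINE of `((η ψ) ∘ det)⁻¹`**: if `R(g) f = (η ψ)(det g) · f` on `P₂` for every `g ∈ U(Φ₂)(𝔸)` (★ `cmDetChar`
at `η ψ`, automorphic by ★ `isAutomorphic_eta_mul_psi`), then `P₂ = ofChar ((η ψ) ∘ det)⁻¹ μ₂` (★ `DiscreteAutomorphicRep.ofChar`) — ★ `eq_ofChar_of_forall_apply_eq_smul` (any datum,
no commutativity) at the locally compact second countable `U(Φ₂)(𝔸_{L⁺})` (★ `locallyCompactSpace_cmDatum_Adelic`, ★ `secondCountableTopology_cmDatum_Adelic`; the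
`adelicGroupData` model is definitionally `cmDatum`, ★ `adelicGroupData_eq_cmDatum`). [cite: Gelbart1975, Thm. 10.10 (proof, p. 158)] [cite: Rogawski1990, §13.3 p. 203] -/
theorem eq_ofChar_of_forall_apply_eq_smul₂
    {μ₂ : Measure (adelicGroupData ↥(maximalRealSubfield L) L (IsCMField.complexConj L) 2 (Matrix.of fun i j : Fin 2 => if i.val + j.val + 1 = 2 then (1 : L) else 0)).automorphicQuotient}
    [(adelicGroupData ↥(maximalRealSubfield L) L (IsCMField.complexConj L) 2 (Matrix.of fun i j : Fin 2 => if i.val + j.val + 1 = 2 then (1 : L) else 0)).IsAutomorphicMeasure μ₂]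
    (P₂ : DiscreteAutomorphicRep (adelicGroupData ↥(maximalRealSubfield L) L (IsCMField.complexConj L) 2 (Matrix.of fun i j : Fin 2 => if i.val + j.val + 1 = 2 then (1 : L) else 0)) μ₂) (ξ : OneDimAutRepH L)
    (hP : ∀ (g : (adelicGroupData ↥(maximalRealSubfield L) L (IsCMField.complexConj L) 2 (Matrix.of fun i j : Fin 2 => if i.val + j.val + 1 = 2 then (1 : L) else 0)).Adelic) (f : P₂.space.toSubmodule),
      P₂.space.toContRep g f = (((cmDetChar L 2 (Matrix.of fun i j : Fin 2 => if i.val + j.val + 1 = 2 then (1 : L) else 0) (ξ.η * ξ.ψ) (isAutomorphic_eta_mul_psi ξ) (isUnit_antidiagOne_det L 2).ne_zero) g : ℂˣ) : ℂ) • f) :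
    P₂ = DiscreteAutomorphicRep.ofChar (cmDetChar L 2 (Matrix.of fun i j : Fin 2 => if i.val + j.val + 1 = 2 then (1 : L) else 0) (ξ.η * ξ.ψ) (isAutomorphic_eta_mul_psi ξ) (isUnit_antidiagOne_det L 2).ne_zero)⁻¹ μ₂ := by
  haveI : LocallyCompactSpace (adelicGroupData ↥(maximalRealSubfield L) L (IsCMField.complexConj L) 2 (Matrix.of fun i j : Fin 2 => if i.val + j.val + 1 = 2 then (1 : L) else 0)).Adelic :=
    locallyCompactSpace_cmDatum_Adelic L 2 _
  haveI : SecondCountableTopology (adelicGroupData ↥(maximalRealSubfield L) L (IsCMField.complexConj L) 2 (Matrix.of fun i j : Fin 2 => if i.val + j.val + 1 = 2 then (1 : L) else 0)).Adelic :=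
    secondCountableTopology_cmDatum_Adelic L 2 _
  refine P₂.eq_ofChar_of_forall_apply_eq_smul μ₂ _ fun g f => ?_
  rw [hP g f, AdelicGroupData.AutomorphicCharacter.coe_inv_apply, inv_inv]

/-- **Two `((η ψ) ∘ det)`-scalar discrete automorphic representations of `U(Φ₂)` in `L²(μ₂)` are EQUAL** (both are the line of `((η ψ) ∘ det)⁻¹`) — multiplicity one for the
automorphic character `(η ψ) ∘ det` of `U(Φ₂)`, the ★ half of O8b. [cite: Rogawski1990, §13.3 p. 203] [cite: Gelbart1975, Thm. 10.10 (proof, p. 158)] -/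
theorem eq_of_forall_apply_eq_smul₂
    {μ₂ : Measure (adelicGroupData ↥(maximalRealSubfield L) L (IsCMField.complexConj L) 2 (Matrix.of fun i j : Fin 2 => if i.val + j.val + 1 = 2 then (1 : L) else 0)).automorphicQuotient}
    [(adelicGroupData ↥(maximalRealSubfield L) L (IsCMField.complexConj L) 2 (Matrix.of fun i j : Fin 2 => if i.val + j.val + 1 = 2 then (1 : L) else 0)).IsAutomorphicMeasure μ₂]
    (P₂ P₂' : DiscreteAutomorphicRep (adelicGroupData ↥(maximalRealSubfield L) L (IsCMField.complexConj L) 2 (Matrix.of fun i j : Fin 2 => if i.val + j.val + 1 = 2 then (1 : L) else 0)) μ₂) (ξ : OneDimAutRepH L)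
    (hP : ∀ (g : (adelicGroupData ↥(maximalRealSubfield L) L (IsCMField.complexConj L) 2 (Matrix.of fun i j : Fin 2 => if i.val + j.val + 1 = 2 then (1 : L) else 0)).Adelic) (f : P₂.space.toSubmodule),
      P₂.space.toContRep g f = (((cmDetChar L 2 (Matrix.of fun i j : Fin 2 => if i.val + j.val + 1 = 2 then (1 : L) else 0) (ξ.η * ξ.ψ) (isAutomorphic_eta_mul_psi ξ) (isUnit_antidiagOne_det L 2).ne_zero) g : ℂˣ) : ℂ) • f)
    (hP' : ∀ (g : (adelicGroupData ↥(maximalRealSubfield L) L (IsCMField.complexConj L) 2 (Matrix.of fun i j : Fin 2 => if i.val + j.val + 1 = 2 then (1 : L) else 0)).Adelic) (f : P₂'.space.toSubmodule),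
      P₂'.space.toContRep g f = (((cmDetChar L 2 (Matrix.of fun i j : Fin 2 => if i.val + j.val + 1 = 2 then (1 : L) else 0) (ξ.η * ξ.ψ) (isAutomorphic_eta_mul_psi ξ) (isUnit_antidiagOne_det L 2).ne_zero) g : ℂˣ) : ℂ) • f) :
    P₂ = P₂' := by
  rw [eq_ofChar_of_forall_apply_eq_smul₂ P₂ ξ hP, eq_ofChar_of_forall_apply_eq_smul₂ P₂' ξ hP']

/-- **«`P₂` realises `ξ` AND is `((η ψ) ∘ det)`-scalar» ↔ «`P₂` is THE line `ofChar ((η ψ) ∘ det)⁻¹ μ₂`»** (the line realises `ξ` by ★ `realises₂_ofChar` and is scalar by ★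
`ofChar_toContRep_apply`). [cite: Rogawski1990, §13.3 pp. 202–203] [cite: Gelbart1975, §2.A] -/
theorem realises₂_and_forall_apply_eq_smul_iff_eq_ofChar
    {μ₂ : Measure (adelicGroupData ↥(maximalRealSubfield L) L (IsCMField.complexConj L) 2 (Matrix.of fun i j : Fin 2 => if i.val + j.val + 1 = 2 then (1 : L) else 0)).automorphicQuotient}
    [(adelicGroupData ↥(maximalRealSubfield L) L (IsCMField.complexConj L) 2 (Matrix.of fun i j : Fin 2 => if i.val + j.val + 1 = 2 then (1 : L) else 0)).IsAutomorphicMeasure μ₂]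
    (P₂ : DiscreteAutomorphicRep (adelicGroupData ↥(maximalRealSubfield L) L (IsCMField.complexConj L) 2 (Matrix.of fun i j : Fin 2 => if i.val + j.val + 1 = 2 then (1 : L) else 0)) μ₂) (ξ : OneDimAutRepH L) :
    (Realises₂ P₂ ξ ∧
      ∀ (g : (adelicGroupData ↥(maximalRealSubfield L) L (IsCMField.complexConj L) 2 (Matrix.of fun i j : Fin 2 => if i.val + j.val + 1 = 2 then (1 : L) else 0)).Adelic) (f : P₂.space.toSubmodule),
        P₂.space.toContRep g f = (((cmDetChar L 2 (Matrix.of fun i j : Fin 2 => if i.val + j.val + 1 = 2 then (1 : L) else 0) (ξ.η * ξ.ψ) (isAutomorphic_eta_mul_psi ξ) (isUnit_antidiagOne_det L 2).ne_zero) g : ℂˣ) : ℂ) • f) ↔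
    P₂ = DiscreteAutomorphicRep.ofChar (cmDetChar L 2 (Matrix.of fun i j : Fin 2 => if i.val + j.val + 1 = 2 then (1 : L) else 0) (ξ.η * ξ.ψ) (isAutomorphic_eta_mul_psi ξ) (isUnit_antidiagOne_det L 2).ne_zero)⁻¹ μ₂ := by
  constructor
  · rintro ⟨-, hP⟩
    exact eq_ofChar_of_forall_apply_eq_smul₂ P₂ ξ hP
  · rintro rfl
    refine ⟨realises₂_ofChar ξ, fun g f => ?_⟩
    rw [DiscreteAutomorphicRep.ofChar_toContRep_apply, AdelicGroupData.AutomorphicCharacter.coe_inv_apply, inv_inv]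

/-! ## §2 O8b ⟸ ISOTYPY: the residual PRINT content of `PKmultOneU2Shape` is «realising the character family ⇒ character-scalar» -/

/-- **UNIQUENESS OF THE REALISING `P₂` AT `(μ₂, ξ)` FROM ISOTYPY** — the premise `hm1` of ★ `F0P3cPKtupleNHOneOfKD5H.nH_eq_one_of_kd5Hflat`: if every discrete automorphic `P₂` in
`L²(μ₂)` realising `ξ_v ∘ inl` at every finite place is `((η ψ) ∘ det)`-scalar (the ISOTYPY text (O8b♭) at `(μ₂, ξ)`, PRINT: [Rogawski1990] §13.3 p. 203 — local: a unitary smooth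
representation of `U(Φ₂)(L⁺_v)` with only the constituent `χ_v` is `χ_v`-isotypic; archimedean: density of `U(Φ₂)(L⁺)` in `U(Φ₂)(L⁺ ⊗ ℝ)`), then two realising `P₂, P₂′` coincide (§1).
[cite: Rogawski1990, §13.3 p. 203] [cite: Gelbart1975, Thm. 10.10 (proof, p. 158)] -/
theorem realises₂_unique_of_isotypy_at
    {μ₂ : Measure (adelicGroupData ↥(maximalRealSubfield L) L (IsCMField.complexConj L) 2 (Matrix.of fun i j : Fin 2 => if i.val + j.val + 1 = 2 then (1 : L) else 0)).automorphicQuotient}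
    [(adelicGroupData ↥(maximalRealSubfield L) L (IsCMField.complexConj L) 2 (Matrix.of fun i j : Fin 2 => if i.val + j.val + 1 = 2 then (1 : L) else 0)).IsAutomorphicMeasure μ₂] (ξ : OneDimAutRepH L)
    (hiso : ∀ P₂ : DiscreteAutomorphicRep (adelicGroupData ↥(maximalRealSubfield L) L (IsCMField.complexConj L) 2 (Matrix.of fun i j : Fin 2 => if i.val + j.val + 1 = 2 then (1 : L) else 0)) μ₂,
      Realises₂ P₂ ξ →
        ∀ (g : (adelicGroupData ↥(maximalRealSubfield L) L (IsCMField.complexConj L) 2 (Matrix.of fun i j : Fin 2 => if i.val + j.val + 1 = 2 then (1 : L) else 0)).Adelic) (f : P₂.space.toSubmodule),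
          P₂.space.toContRep g f = (((cmDetChar L 2 (Matrix.of fun i j : Fin 2 => if i.val + j.val + 1 = 2 then (1 : L) else 0) (ξ.η * ξ.ψ) (isAutomorphic_eta_mul_psi ξ) (isUnit_antidiagOne_det L 2).ne_zero) g : ℂˣ) : ℂ) • f)
    (P₂ P₂' : DiscreteAutomorphicRep (adelicGroupData ↥(maximalRealSubfield L) L (IsCMField.complexConj L) 2 (Matrix.of fun i j : Fin 2 => if i.val + j.val + 1 = 2 then (1 : L) else 0)) μ₂)
    (h : Realises₂ P₂ ξ) (h' : Realises₂ P₂' ξ) : P₂ = P₂' :=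
  eq_of_forall_apply_eq_smul₂ P₂ P₂' ξ (hiso P₂ h) (hiso P₂' h')

/-- **O8b FROM ISOTOPY — `PKmultOneU2Shape L ⟸ (O8b♭)`**: if, for every automorphic measure `μ₂` on `U(Φ₂)` and every one-dimensional automorphic `ξ` of `H`, every discrete
automorphic `P₂` realising `ξ_v ∘ inl` at every finite place is `((η ψ) ∘ det)`-scalar (the ISOTYPY text, PRINT), then the letter O8b ★ `PKmultOneU2Shape L` holds — its
`L²`-multiplicity-one half being ★ `AutomorphicCharacterLineUnique`.  So the GO-time planner may posit (O8b♭) in place of O8b (same print pins; strictly more local content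
named). [cite: Rogawski1990, §13.3 p. 203] [cite: Gelbart1975, Thm. 10.10 (proof, p. 158)] [cite: PlatonovRapinchuk1994, §7.3 Prop. 7.8] -/
theorem pkMultOneU2Shape_of_isotypy
    (hiso : ∀ (μ₂ : Measure (adelicGroupData ↥(maximalRealSubfield L) L (IsCMField.complexConj L) 2 (Matrix.of fun i j : Fin 2 => if i.val + j.val + 1 = 2 then (1 : L) else 0)).automorphicQuotient)
      [(adelicGroupData ↥(maximalRealSubfield L) L (IsCMField.complexConj L) 2 (Matrix.of fun i j : Fin 2 => if i.val + j.val + 1 = 2 then (1 : L) else 0)).IsAutomorphicMeasure μ₂] (ξ : OneDimAutRepH L)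
      (P₂ : DiscreteAutomorphicRep (adelicGroupData ↥(maximalRealSubfield L) L (IsCMField.complexConj L) 2 (Matrix.of fun i j : Fin 2 => if i.val + j.val + 1 = 2 then (1 : L) else 0)) μ₂),
      Realises₂ P₂ ξ →
        ∀ (g : (adelicGroupData ↥(maximalRealSubfield L) L (IsCMField.complexConj L) 2 (Matrix.of fun i j : Fin 2 => if i.val + j.val + 1 = 2 then (1 : L) else 0)).Adelic) (f : P₂.space.toSubmodule),
          P₂.space.toContRep g f = (((cmDetChar L 2 (Matrix.of fun i j : Fin 2 => if i.val + j.val + 1 = 2 then (1 : L) else 0) (ξ.η * ξ.ψ) (isAutomorphic_eta_mul_psi ξ) (isUnit_antidiagOne_det L 2).ne_zero) g : ℂˣ) : ℂ) • f) :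
    PKmultOneU2Shape L :=
  fun μ₂ _ ξ P₂ P₂' h h' => realises₂_unique_of_isotypy_at ξ (hiso μ₂ ξ) P₂ P₂' h h'

/-- **Conversely, O8b ⇒ ISOTYPY**: under the letter `PKmultOneU2Shape L` every realising `P₂` IS the line `ofChar ((η ψ) ∘ det)⁻¹ μ₂` (uniqueness against ★ `realises₂_ofChar`), hence
`((η ψ) ∘ det)`-scalar — so (O8b♭) and O8b are EQUIVALENT letters over the ★ tree. [cite: Rogawski1990, §13.3 p. 203] [cite: Gelbart1975, §2.A] -/
theorem forall_apply_eq_smul_of_pkMultOneU2Shape (hO8b : PKmultOneU2Shape L)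
    {μ₂ : Measure (adelicGroupData ↥(maximalRealSubfield L) L (IsCMField.complexConj L) 2 (Matrix.of fun i j : Fin 2 => if i.val + j.val + 1 = 2 then (1 : L) else 0)).automorphicQuotient}
    [(adelicGroupData ↥(maximalRealSubfield L) L (IsCMField.complexConj L) 2 (Matrix.of fun i j : Fin 2 => if i.val + j.val + 1 = 2 then (1 : L) else 0)).IsAutomorphicMeasure μ₂] (ξ : OneDimAutRepH L)
    (P₂ : DiscreteAutomorphicRep (adelicGroupData ↥(maximalRealSubfield L) L (IsCMField.complexConj L) 2 (Matrix.of fun i j : Fin 2 => if i.val + j.val + 1 = 2 then (1 : L) else 0)) μ₂) (h : Realises₂ P₂ ξ)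
    (g : (adelicGroupData ↥(maximalRealSubfield L) L (IsCMField.complexConj L) 2 (Matrix.of fun i j : Fin 2 => if i.val + j.val + 1 = 2 then (1 : L) else 0)).Adelic) (f : P₂.space.toSubmodule) :
    P₂.space.toContRep g f = (((cmDetChar L 2 (Matrix.of fun i j : Fin 2 => if i.val + j.val + 1 = 2 then (1 : L) else 0) (ξ.η * ξ.ψ) (isAutomorphic_eta_mul_psi ξ) (isUnit_antidiagOne_det L 2).ne_zero) g : ℂˣ) : ℂ) • f := by
  have hP : P₂ = DiscreteAutomorphicRep.ofChar (cmDetChar L 2 (Matrix.of fun i j : Fin 2 => if i.val + j.val + 1 = 2 then (1 : L) else 0) (ξ.η * ξ.ψ) (isAutomorphic_eta_mul_psi ξ) (isUnit_antidiagOne_det L 2).ne_zero)⁻¹ μ₂ :=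
    hO8b μ₂ ξ P₂ _ h (realises₂_ofChar ξ)
  exact ((realises₂_and_forall_apply_eq_smul_iff_eq_ofChar P₂ ξ).2 hP).2 g f

/-- **Under O8b, `Realises₂ P₂ ξ ↔ P₂ = ofChar ((η ψ) ∘ det)⁻¹ μ₂`** — the `U(Φ₂)` twin of ★ `realises₁_iff_eq_ofChar` (which needs no letter, `U(Φ₁)` being commutative).
[cite: Rogawski1990, §13.3 pp. 202–203] [cite: Gelbart1975, §2.A] -/
theorem realises₂_iff_eq_ofChar_of_pkMultOneU2Shape (hO8b : PKmultOneU2Shape L)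
    {μ₂ : Measure (adelicGroupData ↥(maximalRealSubfield L) L (IsCMField.complexConj L) 2 (Matrix.of fun i j : Fin 2 => if i.val + j.val + 1 = 2 then (1 : L) else 0)).automorphicQuotient}
    [(adelicGroupData ↥(maximalRealSubfield L) L (IsCMField.complexConj L) 2 (Matrix.of fun i j : Fin 2 => if i.val + j.val + 1 = 2 then (1 : L) else 0)).IsAutomorphicMeasure μ₂] (ξ : OneDimAutRepH L)
    (P₂ : DiscreteAutomorphicRep (adelicGroupData ↥(maximalRealSubfield L) L (IsCMField.complexConj L) 2 (Matrix.of fun i j : Fin 2 => if i.val + j.val + 1 = 2 then (1 : L) else 0)) μ₂) :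
    Realises₂ P₂ ξ ↔ P₂ = DiscreteAutomorphicRep.ofChar (cmDetChar L 2 (Matrix.of fun i j : Fin 2 => if i.val + j.val + 1 = 2 then (1 : L) else 0) (ξ.η * ξ.ψ) (isAutomorphic_eta_mul_psi ξ) (isUnit_antidiagOne_det L 2).ne_zero)⁻¹ μ₂ :=
  ⟨fun h => hO8b μ₂ ξ P₂ _ h (realises₂_ofChar ξ), fun h => h ▸ realises₂_ofChar ξ⟩

end Summit.HodgeConjecture.HodgeConjecture.Cruxes.H413.F0P3cPKtupleU2LineUnique

end
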